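import Summits.QuantumFields.YangMills.Theorems.UnitScaleTiltProp7SectET3N06LeavesRecordNormG
import Summits.QuantumFields.YangMills.Theorems.UnitScaleTiltProp7SectET3KernelFamilyCanonical
import Summits.QuantumFields.YangMills.Theorems.UnitScaleTiltProp7SectET3OpsSymmetry
import HarnessLib

/-!
# Route `UnitScaleTilt` (α), node N06(d = 3) — **THE `norm_G` ROW OF C-min FROM THE RECORD-SPECIES OBLIGATIONS WITH THE SEVEN STRUCTURAL ROWS, THE KERNEL FAMILY AND THE
# (3.47) PIN DISCHARGED**: ✓ `Prop7SectET3N06LeavesRecordNormG.normG_row_of_recordObligations` (p605632-class, the text of record of INPUT-LIST I-06) re-issued WITHOUT the binders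
# `GG` (the kernel family), `hcoR hco1R hcoG hl2N hH1N hIF` (its six co-reading rows), `hsymGG` (symmetry) and `hglob` (the (115)-pin on `GG`'s (3.47) entries) — replaced by TEN
# K-free EVALUATION ROWS, ONE four-conjunct LETTER-SYMMETRY ROW and ONE K-free READOUT ROW; every other binder VERBATIM

Cell `ym-inputs` (D-0154 (2); desk `ym-inputs-plan-1` INPUT-LIST v5 §4 row p05 = I-06 (d) «the structural rows `hcoR hco1R hcoG hl2N hH1N hIF hsymGG` … for a concrete `𝔬_T3`»),
seat ym-inputs-p05.  Count-neutral helper (`--supports stmt-QuantumFields-20520 --as helper`; RULING g26-№2 «B0 needs N06(d = 3)»); registry untouched; THEOREMS ONLY (0 `def`,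
0 `sorry`); NOTHING of [Balaban1985BackgroundPropagators] is asserted.

THE COMPOSITION (three `have`s and one `exact`).  ✓ `Prop7SectET3KernelFamilyCanonical.exists_kernelFamily_structural` (F2) gives, member by member (`choose`), ONE canonical
`GG i : B9.KernelFamily (geo9K i) (bgT3 i)` inhabiting the six co-reading rows at (`Rel := RelB i`, `R := 1`, `H := H₀ i`) from the evaluation rows `hoff … hlocle` and the sign facts
✓ `modelSignsOn_geo9K` ∕ ✓ `geoOK_geo9K` — WITH the dominations of `𝔊(U)`, `∇_U𝔊(U)` by the (3.47) entries `glob 0`, `glob 1`; ✓ `Prop7SectET3OpsSymmetry.hsymGG_row_of_letterSymm`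
(F1) gives `hsymGG` from the `Identities` conjunct of `hmodel` and the letter-symmetry row `hls`; the readout row `hread` («‖Gop i U f‖ is below every common constant `C ≥ 0` with
`|(𝔊λ)(x)| ≤ C·(Lʲη)²·(L^{j(x)}η)⁻³` and `|(∇_U𝔊λ)(x′)| ≤ C·(Lʲη)·(L^{j(x′)}η)⁻³`, `λ := ιo i U f`» — the (115)∕(117) reading of the route's normed letter) gives `hglob` at
`C := max (glob 0) (glob 1)`; then `normG_row_of_recordObligations` BY NAME.
NET FOR SUB-ROW (d) OF I-06: the concrete T³ operator instance (layer 0 of WANTED №g25-1: `𝔬_T3`, `ev`, `evY`, `𝔭`, `bHX`, …) owes NO kernel family, NO co-reading row, NO symmetry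
row and NO (3.47) pin — it owes ten evaluation facts about its own `ev`∕`evY`∕`bHX` (support, size, weighted size, block-L² size, Hölder localisation), four letter symmetries
(Δ_a, Δ′_π, Δ⁽²⁾_π symmetric; ∇*_U the adjoint of ∇_U) and the readout of its normed letter; the ANALYTIC rows (`hmodel` = Thm 3.3 for G₀ (XL), steps, letters, (3.43)–(3.46)
members) and `ClassTransferT3` are untouched and remain displayed exactly as at the record.
HONEST SCOPE: bookkeeping; N06(d = 3) NOT discharged; nothing here claims EX, the crux, V3∕R3, d = 4 or the mass gap; YM₃ on T³ is ladder rung R3, not the Clay problem.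

References: T. Bałaban, CMP **99** (1985) 389–434 [Balaban1985BackgroundPropagators] ((3.39)–(3.47) pp.397–398, Thm 3.13 p.426, (3.153) p.426); CMP **102** (1985) 277–309
[Balaban1985Variational] ((115) p.294, (117) p.295); CMP **99** (1985) 75–102 [Balaban1985RegularSpaces] ((1.33) p.82).
-/

set_option autoImplicit false

noncomputable section

open scoped Matrix.Norms.L2Operator

namespace Summit.QuantumFields.YangMills.Theorems.Prop7SectET3N06LeavesRecordNormGReduced

open Literature.MathematicalPhysics.QuantumFieldTheory.Balaban1983to89
open Finset B6RandomWalk B6RandomWalkHom B9Thm34Ext B9Thm37GlueCor36 B11SectG B9SectDSup B9Thm37AllNorms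
open B9Thm37AllNormsInstances B9FromB6 B9FromB6ModelSignsOn B9SectBStepWhole B9Thm312Whole B9Thm312WholeLeaf B9Thm312WholeLeft B9Thm313Whole
open B9Thm313WholeLeft B9Thm312WholeLeafLeftGlob B9Ineq347CoReading B9SectCDiffDict B9CoRealizesRel B9Thm37Glue B9SectDL2Decay B9RWSums343Holder
open B9RWSumsReadsRel B9RWSumsReadsNbr B9Ineq347 B9Thm312WholeClasses B9Thm312WholeL2 B9Thm312WholeBlocksRel B9Thm312WholeBlocksNbr B9Thm313WholeLeafRel
open B9Thm312WholeHolder B9Thm312WholeHHolder B9Thm313WholeHolder B9Thm313WholeL2G B9Thm313WholeL2GP B9Thm313WholeInput B9Thm313WholeBlocksNbr B9Thm312WholeLeafAll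
open B9RWSums346SecondDiff B9Thm313WholeBlocksNbrRec B9RWSums344InputFam B9Thm312WholeDir B9Thm312WholeBlocksPairM B9Thm313WholeDir B9Thm313WholeDirInput B9Thm313WholeBlocksPairM
open B9Thm313WholeLeafCompletePairM B9Thm312WholeDirB B9Thm313WholeDirInputB B9Thm313WholeBlocksPairMB B9Thm313WholeLeafCompletePairMB B9Thm313WholeBlocksPairMZ B9Thm313WholeBlocksPairMBZ B9Thm313WholeLeafRelZ
open B9Thm312WholeHZ B9Thm313WholeZ B9Thm313WholeLeftZ B9Thm313WholeHolderZ B9Thm313WholeInputZ B9Thm313WholeDirZ B9Thm313WholeDirInputZ B9Thm313WholeDirInputBZ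
open B9Thm313WholeL2GZ B9Thm313WholeL2GPZ B9Thm313WholeDirL2Z B9Thm313WholeLeafCompletePairMBZ
open B6KLevelCensusIndexV1 (KIdx)
open B9GeoNormsKLevelV1 (geo9K)
open B9CoRealizesRelAtLetters (RelB)
open B9GeoNormsKLevelModelSignsV1 (modelSignsOn_geo9K)
open Summit.QuantumFields.YangMills.Theorems.Prop7SectET3Members (hd3 memberIdx)
open Summit.QuantumFields.YangMills.Theorems.Prop7SectET3Geometry (geoOK_geo9K)
open Summit.QuantumFields.YangMills.Theorems.Prop7SectET3BgClass (bgT3 cfgV1OfT3 ClassTransferT3)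
open Summit.QuantumFields.YangMills.Theorems.Prop7SectET3Letters (LettersRowZT3)
open Summit.QuantumFields.YangMills.Theorems.Prop7SectET3N06LeavesRecordNormG (normG_row_of_recordObligations)
open Summit.QuantumFields.YangMills.Theorems.Prop7SectET3KernelFamilyCanonical (exists_kernelFamily_structural)
open Summit.QuantumFields.YangMills.Theorems.Prop7SectET3OpsSymmetry (hsymGG_row_of_letterSymm)
open T3ContinuumYM3Torus T3PrintedRegularMinimiser B6GlobalChartV1

variable {ℓ : ℕ} {hL : Odd (ℓ + 1) ∧ 1 < ℓ + 1} {c35 : ℝ}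

/-- ★★★ **THE `norm_G` ROW OF C-min FROM THE RECORD-SPECIES N06(d = 3) OBLIGATIONS — KERNEL FAMILY, CO-READINGS, SYMMETRY AND (3.47) PIN DISCHARGED.**  The binders of ✓
`normG_row_of_recordObligations` VERBATIM (operator letters `𝔬`, probes `𝔭`, block norms `bH bHX bHW`, direction letters `Dd Dds`, evaluations `ev evY`, numerics, `hmodel` (Thm 3.3 for
`G₀` = XL), `hleft`, Z-classed letters `hletters`∕`hlettersD`, `hG0C`, steps, H-letters, L² letters, input letters, `ClassTransferT3 ℓ hL c35`, the normed family `Gop` with its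
argument map `ιo` and the (3.41) weight pin `hw`) EXCEPT: NO kernel family `GG`, NO rows `hcoR hco1R hcoG hsymGG hl2N hH1N hIF`, NO pin `hglob`; INSTEAD the ten K-free evaluation
rows `hoff hoffY hbd hbdY hwb hwbY hl2b hl2bY hloc hlocle` (support ∕ size ∕ weighted size ∕ block-L² size ∕ Hölder localisation of `ev i λ`, `evY i λ`), the letter-symmetry row
`hls` (Δ_a = `S0`, Δ′_π = `Tpi`, Δ⁽²⁾_π = `T2` symmetric, (∇_U, ∇*_U) = (`D`, `Dstar`) a transpose pair, under the printed provisos) and the readout row `hread` (‖Gop i U f‖ below every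
common `C ≥ 0` bounding `|(𝔊λ)(x)|∕((Lʲη)²(Lʲη)⁻³)` and `|(∇_U𝔊λ)(x′)|∕((Lʲη)(Lʲη)⁻³)`, `λ = ιo i U f`).  Conclusion VERBATIM: `∃ M₄ a₀ B₀′ > 0, ∀ member … , RegPr … e U₀ →
e ≤ a₀∕(L·L^{a'}) → ∀ f, ‖Gop (memberIdx …) (cfgV1OfT3 U₀) f‖ ≤ B₀′‖f‖`.  Nothing of print asserted; NOT a discharge of N06(d = 3).
[cite: Balaban1985Variational, (117) p.295; Balaban1985BackgroundPropagators, Thm 3.13 p.426, (3.41)–(3.47) pp.397–398, (3.153) p.426; Balaban1985RegularSpaces, (1.33) p.82] -/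
theorem normG_row_of_evaluationRows [∀ i : KIdx 2 ℓ hd3 hL 1 1, Fintype (geo9K i).Site] [∀ i : KIdx 2 ℓ hd3 hL 1 1, DecidableEq (geo9K i).Site]
    {X Y Z W PX PY : KIdx 2 ℓ hd3 hL 1 1 → Type} {P : Type} [∀ i, Fintype (X i)] [∀ i, DecidableEq (X i)] [∀ i, Fintype (Y i)]
    [∀ i, Fintype (Z i)] [∀ i, Fintype (W i)] [∀ i, Fintype (PX i)] [∀ i, Fintype (PY i)] [Fintype P]
    (𝔬 : ∀ i : KIdx 2 ℓ hd3 hL 1 1, Ops (geo9K i) (bgT3 i) (X i) (Y i) (Z i) (W i)) (H₀ : KIdx 2 ℓ hd3 hL 1 1 → Prop)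
    (bH : ∀ i : KIdx 2 ℓ hd3 hL 1 1, BlockNorm (toB6 (geo9K i) 1 (H₀ i)) (W i → ℝ))
    (𝔭 : ∀ i : KIdx 2 ℓ hd3 hL 1 1, HolderProbes (geo9K i) (bgT3 i) (X i) (Y i) (PX i) (PY i))
    (bHX : ∀ i : KIdx 2 ℓ hd3 hL 1 1, ℝ → BlockNorm (toB6 (geo9K i) 1 (H₀ i)) (X i → ℝ))
    (Dd Dds : ∀ i : KIdx 2 ℓ hd3 hL 1 1, (bgT3 i).Cfg → P → Module.End ℝ (X i → ℝ))
    (bHW : ∀ i : KIdx 2 ℓ hd3 hL 1 1, ℝ → BlockNorm (toB6 (geo9K i) 1 (H₀ i)) (W i → ℝ))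
    (ev : ∀ i : KIdx 2 ℓ hd3 hL 1 1, (geo9K i).Loc → X i → ℝ) (evY : ∀ i : KIdx 2 ℓ hd3 hL 1 1, (geo9K i).Loc → Y i → ℝ)
    (r Cev θ₁ θD θ₂ r₁ B₀ B₂ B₄ δ₀ δK σ ρ a₁ M₁ B₃ δ₃ ρ' α κ₀ : ℝ) (Bh Bi Bq BhD Bx Bd θH θI θV Br : ℝ → ℝ)
    (Bi2 Bd2 : ℝ → ℝ → ℝ)
    (hθ₁ : 0 ≤ θ₁) (hθD : 0 ≤ θD) (hθH : ∀ β, 0 ≤ β → β < 1 → 0 ≤ θH β) (hθI : ∀ ε, 0 < ε → 0 ≤ θI ε) (hθ₂ : 0 ≤ θ₂)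
    (hθV : ∀ ε, 0 < ε → 0 ≤ θV ε) (hr₁ : 0 ≤ r₁) (hB₀ : 0 ≤ B₀) (hB₂ : 0 ≤ B₂)
    (hB₃ : 0 ≤ B₃) (hB₄ : 0 ≤ B₄) (hBr : ∀ ε, 0 < ε → 0 ≤ Br ε) (hσ : 0 < σ) (hρ' : 0 < ρ') (hρ'ρ : ρ' + 3 * σ ≤ ρ) (hρ'ρ₅ : ρ' + 5 * σ ≤ ρ)
    (hσρ' : 3 * σ < (1 - α) * ρ')
    (hρS : ρ ≤ δ₀) (hρ₃ : ρ ≤ δ₃) (hρδ : ρ + σ ≤ δK) (ha₁ : 0 < a₁) (hM₁ : 0 < M₁)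
    (hα0 : 0 < α) (hα1 : α < 1) (hBi : ∀ ε, 0 < ε → ε ≤ 1 → 0 ≤ Bi ε) (hBd : ∀ ε, 0 < ε → ε ≤ 1 → 0 ≤ Bd ε)
    (hBi2 : ∀ ε β, 0 < ε → ε ≤ 1 → 0 ≤ β → β < 1 → 0 ≤ Bi2 ε β) (hBd2 : ∀ ε β, 0 < ε → ε ≤ 1 → 0 ≤ β → β < 1 → 0 ≤ Bd2 ε β)
    (hBh : ∀ β, 0 ≤ β → β < 1 → 0 ≤ Bh β) (hBq : ∀ β, 0 ≤ β → β < 1 → 0 ≤ Bq β) (hBhD : ∀ β, 0 ≤ β → β < 1 → 0 ≤ BhD β)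
    (hBx : ∀ β, 0 ≤ β → β < 1 → 0 ≤ Bx β) (hCev : 0 ≤ Cev)
    (hκ : ∀ i : KIdx 2 ℓ hd3 hL 1 1, (bH i).κ ≤ κ₀)
    (hκW : ∀ (i : KIdx 2 ℓ hd3 hL 1 1) (ε : ℝ), (bHW i ε).κ ≤ κ₀)
    -- ======== the TEN K-free EVALUATION ROWS (replace the kernel family `GG` and its six co-reading rows) ========
    (hoff : ∀ (i : KIdx 2 ℓ hd3 hL 1 1) (lam : (geo9K i).Loc) (y' : (geo9K i).Site), (geo9K i).suppIn lam y' →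
      ∀ x : X i, ¬ RelB i ((𝔬 i).blk x) y' → ev i lam x = 0)
    (hoffY : ∀ (i : KIdx 2 ℓ hd3 hL 1 1) (lam : (geo9K i).Loc) (y' : (geo9K i).Site), (geo9K i).suppIn lam y' →
      ∀ w : Y i, ¬ RelB i ((𝔬 i).blkY w) y' → evY i lam w = 0)
    (hbd : ∀ (i : KIdx 2 ℓ hd3 hL 1 1) (lam : (geo9K i).Loc) (x : X i), |ev i lam x| ≤ (geo9K i).supNorm lam)
    (hbdY : ∀ (i : KIdx 2 ℓ hd3 hL 1 1) (lam : (geo9K i).Loc) (w : Y i), |evY i lam w| ≤ (geo9K i).supNorm lam)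
    (hwb : ∀ (i : KIdx 2 ℓ hd3 hL 1 1) (lam : (geo9K i).Loc) (γ : ℝ) (x : X i), |ev i lam x| ≤ (geo9K i).len ((𝔬 i).blk x) ^ γ * (geo9K i).wNorm γ lam)
    (hwbY : ∀ (i : KIdx 2 ℓ hd3 hL 1 1) (lam : (geo9K i).Loc) (γ : ℝ) (w : Y i), |evY i lam w| ≤ (geo9K i).len ((𝔬 i).blkY w) ^ γ * (geo9K i).wNorm γ lam)
    (hl2b : ∀ (i : KIdx 2 ℓ hd3 hL 1 1) (lam : (geo9K i).Loc) (y' y'' : (geo9K i).Site), (geo9K i).suppIn lam y' → RelB i y'' y' →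
      bl2 (g := toB6 (geo9K i) 1 (H₀ i)) (𝔬 i).blk y'' (ev i lam) ≤ Cev * (geo9K i).l2Norm lam)
    (hl2bY : ∀ (i : KIdx 2 ℓ hd3 hL 1 1) (lam : (geo9K i).Loc) (y' y'' : (geo9K i).Site), (geo9K i).suppIn lam y' → RelB i y'' y' →
      bl2 (g := toB6 (geo9K i) 1 (H₀ i)) (𝔬 i).blkY y'' (evY i lam) ≤ Cev * (geo9K i).l2Norm lam)
    (hloc : ∀ (i : KIdx 2 ℓ hd3 hL 1 1) (ε : ℝ) (lam : (geo9K i).Loc) (y' : (geo9K i).Site), (geo9K i).suppInT lam y' → (bHX i ε).IsLoc y' (ev i lam))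
    (hlocle : ∀ (i : KIdx 2 ℓ hd3 hL 1 1) (ε : ℝ) (lam : (geo9K i).Loc) (y' : (geo9K i).Site), (geo9K i).suppInT lam y' →
      (bHX i ε).loc y' (ev i lam) ≤ (geo9K i).holder ε lam + (geo9K i).supNorm lam)
    -- ======== the LETTER-SYMMETRY ROW (replaces `hsymGG`) ========
    (hls : ∀ i : KIdx 2 ℓ hd3 hL 1 1, M₁ ≤ (geo9K i).M → ∀ α₀ : ℝ, 0 < α₀ → (geo9K i).M * α₀ ≤ a₁ →
      ∀ U : (bgT3 i).Cfg, (bgT3 i).Reg335 c35 α₀ U → (bgT3 i).Reg336 c35 α₀ U →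
        IsTransposePair ((𝔬 i).S0 U) ((𝔬 i).S0 U) ∧ IsTransposePair ((𝔬 i).Tpi U) ((𝔬 i).Tpi U) ∧
          IsTransposePair ((𝔬 i).T2 U) ((𝔬 i).T2 U) ∧ IsTransposePair ((𝔬 i).D U) ((𝔬 i).Dstar U))
    -- ======== the analytic rows, VERBATIM ========
    (hmodel : ∀ i : KIdx 2 ℓ hd3 hL 1 1, M₁ ≤ (geo9K i).M → ∀ α₀ : ℝ, 0 < α₀ → (geo9K i).M * α₀ ≤ a₁ →
      ∀ U : (bgT3 i).Cfg, (bgT3 i).Reg335 c35 α₀ U → (bgT3 i).Reg336 c35 α₀ U →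
        Thm33G0 (𝔬 i) 1 (H₀ i) B₀ δ₀ U ∧
        Step (𝔬 i) 1 (H₀ i) (geoOK_geo9K i).lenle 1 (θ₁ * ((geo9K i).M * α₀)) δK U ∧
        Step (𝔬 i) 1 (H₀ i) (geoOK_geo9K i).lenle 2 (θ₁ * ((geo9K i).M * α₀)) δK U ∧
        FormSmall (𝔬 i) (r₁ * ((geo9K i).M * α₀)) U ∧ Identities (𝔬 i) U)
    (hleft : ∀ i : KIdx 2 ℓ hd3 hL 1 1, M₁ ≤ (geo9K i).M → ∀ α₀ : ℝ, 0 < α₀ → (geo9K i).M * α₀ ≤ a₁ →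
      ∀ U : (bgT3 i).Cfg, (bgT3 i).Reg335 c35 α₀ U → (bgT3 i).Reg336 c35 α₀ U →
        LeftStep (𝔬 i) 1 (H₀ i) (geoOK_geo9K i).lenle B₀ δ₀ (θD * ((geo9K i).M * α₀)) δK U)
    (wZ : ∀ i : KIdx 2 ℓ hd3 hL 1 1, (geo9K i).Site → ℝ) (hwZ : ∀ i y, 0 < wZ i y)
    (hletters : LettersRowZT3 𝔬 (fun _ => 1) H₀ wZ hwZ c35 a₁ M₁ B₃ δ₃)
    (hlettersD : ∀ i : KIdx 2 ℓ hd3 hL 1 1, M₁ ≤ (geo9K i).M → ∀ α₀ : ℝ, 0 < α₀ → (geo9K i).M * α₀ ≤ a₁ →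
      ∀ U : (bgT3 i).Cfg, (bgT3 i).Reg335 c35 α₀ U → (bgT3 i).Reg336 c35 α₀ U →
        Letters313DZ (𝔬 i) 1 (H₀ i) (geoOK_geo9K i) (wZ i) (hwZ i) B₃ δ₃ (bH i) U ∧
          Letters313DMZ (𝔬 i) (𝔭 i) (Dd i) 1 (H₀ i) (geoOK_geo9K i) (wZ i) (hwZ i) B₃ Bq δ₃ (bH i) U)
    (hG0C : ∀ i : KIdx 2 ℓ hd3 hL 1 1, M₁ ≤ (geo9K i).M → ∀ α₀ : ℝ, 0 < α₀ → (geo9K i).M * α₀ ≤ a₁ →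
      ∀ U : (bgT3 i).Cfg, (bgT3 i).Reg335 c35 α₀ U → (bgT3 i).Reg336 c35 α₀ U →
        Thm33G0Dir (𝔬 i) (𝔭 i) (Dd i) (Dds i) 1 (H₀ i) (bHX i) B₀ Bh Bi Bi2 δ₀ U ∧
          Thm33G0DirR (𝔬 i) (Dds i) 1 (H₀ i) B₀ δ₀ U)
    (hstepD : ∀ i : KIdx 2 ℓ hd3 hL 1 1, M₁ ≤ (geo9K i).M → ∀ α₀ : ℝ, 0 < α₀ → (geo9K i).M * α₀ ≤ a₁ →
      ∀ U : (bgT3 i).Cfg, (bgT3 i).Reg335 c35 α₀ U → (bgT3 i).Reg336 c35 α₀ U →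
        StepDirB (𝔬 i) (𝔭 i) (Dd i) (Dds i) 1 (H₀ i) (bHX i) (geoOK_geo9K i).lenle (θD * ((geo9K i).M * α₀))
          (fun β => θH β * ((geo9K i).M * α₀)) (fun ε => θI ε * ((geo9K i).M * α₀)) δK U)
    (hLHH : ∀ i : KIdx 2 ℓ hd3 hL 1 1, M₁ ≤ (geo9K i).M → ∀ α₀ : ℝ, 0 < α₀ → (geo9K i).M * α₀ ≤ a₁ →
      ∀ U : (bgT3 i).Cfg, (bgT3 i).Reg335 c35 α₀ U → (bgT3 i).Reg336 c35 α₀ U →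
        LettersHHZ (𝔬 i) (𝔭 i) 1 (H₀ i) (geoOK_geo9K i).lenle
          (weightNorm (BlockNorm.ofBlocks (toB6 (geo9K i) 1 (H₀ i)) (𝔬 i).blkZ) (wZ i) fun y => (hwZ i y).le) Bq δ₃ U)
    (hLH3 : ∀ i : KIdx 2 ℓ hd3 hL 1 1, M₁ ≤ (geo9K i).M → ∀ α₀ : ℝ, 0 < α₀ → (geo9K i).M * α₀ ≤ a₁ →
      ∀ U : (bgT3 i).Cfg, (bgT3 i).Reg335 c35 α₀ U → (bgT3 i).Reg336 c35 α₀ U →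
        Letters313HZ (𝔬 i) (𝔭 i) 1 (H₀ i) (geoOK_geo9K i) (wZ i) (hwZ i) (bH i) BhD Bx δ₃ U)
    (hG0L2 : ∀ i : KIdx 2 ℓ hd3 hL 1 1, M₁ ≤ (geo9K i).M → ∀ α₀ : ℝ, 0 < α₀ → (geo9K i).M * α₀ ≤ a₁ →
      ∀ U : (bgT3 i).Cfg, (bgT3 i).Reg335 c35 α₀ U → (bgT3 i).Reg336 c35 α₀ U →
        Thm33G0L2M (𝔬 i) (Dd i) (Dds i) 1 (H₀ i) B₂ δ₀ U)
    (hstepL2 : ∀ i : KIdx 2 ℓ hd3 hL 1 1, M₁ ≤ (geo9K i).M → ∀ α₀ : ℝ, 0 < α₀ → (geo9K i).M * α₀ ≤ a₁ →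
      ∀ U : (bgT3 i).Cfg, (bgT3 i).Reg335 c35 α₀ U → (bgT3 i).Reg336 c35 α₀ U →
        StepL2 (𝔬 i) 1 (H₀ i) (θ₂ * ((geo9K i).M * α₀)) δK U)
    (vZ : ∀ i : KIdx 2 ℓ hd3 hL 1 1, (geo9K i).Site → ℝ) (hvZ : ∀ i y, 0 < vZ i y)
    (hLL2 : ∀ i : KIdx 2 ℓ hd3 hL 1 1, M₁ ≤ (geo9K i).M → ∀ α₀ : ℝ, 0 < α₀ → (geo9K i).M * α₀ ≤ a₁ →
      ∀ U : (bgT3 i).Cfg, (bgT3 i).Reg335 c35 α₀ U → (bgT3 i).Reg336 c35 α₀ U →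
        Letters313L2PZ (𝔬 i) (Dd i) (Dds i) 1 (H₀ i) B₄ δ₃ (vZ i) (hvZ i) U ∧
          Letters313L2MZ (𝔬 i) (Dd i) (Dds i) 1 (H₀ i) B₄ δ₃ (vZ i) (hvZ i) U)
    (hLIM : ∀ i : KIdx 2 ℓ hd3 hL 1 1, M₁ ≤ (geo9K i).M → ∀ α₀ : ℝ, 0 < α₀ → (geo9K i).M * α₀ ≤ a₁ →
      ∀ U : (bgT3 i).Cfg, (bgT3 i).Reg335 c35 α₀ U → (bgT3 i).Reg336 c35 α₀ U →
        Letters313IMB (𝔬 i) (𝔭 i) (Dd i) (Dds i) 1 (H₀ i) (geoOK_geo9K i).lenle (bHX i) (bHW i) Br (fun ε => θV ε * ((geo9K i).M * α₀))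
          Bd Bd2 δ₃ δK U)
    -- ======== the class-transfer row (BG-336), the normed operator family, its (3.41) weight pin and the K-free READOUT ROW (replaces `hglob`) ========
    (hCT : ClassTransferT3 ℓ hL c35)
    {Xo Yo : ∀ i : KIdx 2 ℓ hd3 hL 1 1, (bgT3 i).Cfg → Type} [∀ i U, SeminormedAddCommGroup (Xo i U)] [∀ i U, SeminormedAddCommGroup (Yo i U)]
    (Gop : ∀ (i : KIdx 2 ℓ hd3 hL 1 1) (U : (bgT3 i).Cfg), Xo i U → Yo i U) (ιo : ∀ (i : KIdx 2 ℓ hd3 hL 1 1) (U : (bgT3 i).Cfg), Xo i U → (geo9K i).Loc)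
    (hw : ∀ (i : KIdx 2 ℓ hd3 hL 1 1) (U : (bgT3 i).Cfg) (f : Xo i U), (geo9K i).wNorm (-3) (ιo i U f) ≤ ‖f‖)
    (hread : ∀ (i : KIdx 2 ℓ hd3 hL 1 1) (U : (bgT3 i).Cfg) (f : Xo i U) (C : ℝ), 0 ≤ C →
      (∀ x : X i, |(𝔬 i).GG U (ev i (ιo i U f)) x| ≤ C * B9.pref4 ((geo9K i).len ((𝔬 i).blk x)) 0 * (geo9K i).len ((𝔬 i).blk x) ^ (-3 : ℝ)) →
      (∀ w : Y i, |((𝔬 i).D U ∘ₗ (𝔬 i).GG U) (ev i (ιo i U f)) w| ≤ C * B9.pref4 ((geo9K i).len ((𝔬 i).blkY w)) 1 * (geo9K i).len ((𝔬 i).blkY w) ^ (-3 : ℝ)) →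
        ‖Gop i U f‖ ≤ C) :
    ∃ M₄ a₀ B₀' : ℝ, 0 < M₄ ∧ 0 < a₀ ∧ 0 < B₀' ∧
      ∀ (hℓ : 4 ≤ ℓ) (m : ℕ) (hm : 1 ≤ m) (n K a' R : ℕ) (hk1 : 1 ≤ K - n) (hsize : a' + 3 ≤ m + n) (hM8 : 8 ≤ (ℓ + 1) ^ a') (hR2 : 2 * (ℓ + 1) ^ 2 ≤ R),
        M₄ ≤ ((ℓ + 1 : ℕ) : ℝ) * (((ℓ + 1) ^ a' : ℕ) : ℝ) →
        ∀ (e : ℝ) (U₀ : GaugeField (PV 2 ℓ m K hd3 hL) 0 (Matrix.specialUnitaryGroup (Fin 2) ℂ)),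
          RegPr (⟨ℓ + 1, hL, m, hm⟩ : T3Family) n K e U₀ → e ≤ a₀ / (((ℓ + 1 : ℕ) : ℝ) * (((ℓ + 1) ^ a' : ℕ) : ℝ)) →
            ∀ f : Xo (memberIdx ℓ hL hℓ m hm n K a' R hk1 hsize hM8 hR2) (cfgV1OfT3 U₀),
              ‖Gop (memberIdx ℓ hL hℓ m hm n K a' R hk1 hsize hM8 hR2) (cfgV1OfT3 U₀) f‖ ≤ B₀' * ‖f‖ := by
  -- (1) the canonical kernel family, member by member (F2)
  have hK := fun i : KIdx 2 ℓ hd3 hL 1 1 =>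
    exists_kernelFamily_structural (R := (1 : ℝ)) (H := H₀ i) (𝔬 i).GG (𝔬 i).D (𝔬 i).Dstar (Dd i) (Dds i) (𝔭 i) (bHX i) (𝔬 i).blk (𝔬 i).blkY (ev i) (evY i)
      (RelB i) r Cev (fun _ _ _ => 0) (fun _ _ _ => 0) (hoff i) (hoffY i) (hbd i) (hbdY i) (hwb i) (hwbY i) (hl2b i) (hl2bY i) (hloc i) (hlocle i)
      (modelSignsOn_geo9K i).supNorm_nonneg (modelSignsOn_geo9K i).l2Norm_nonneg (modelSignsOn_geo9K i).cutSup_nonneg (modelSignsOn_geo9K i).cutH_nonneg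
      (modelSignsOn_geo9K i).holder_nonneg (geoOK_geo9K i).lenpos
  choose GG _h3 _hg3 hcoR hco1R hcoG hl2N hH1N hIF _hd0 _hd1 _hd2 _hd4 hgd0 hgd1 _hgd2 hsg using hK
  -- (2) the symmetry row (F1) from the `Identities` conjunct of `hmodel` and the letter symmetries
  have hsymGG := hsymGG_row_of_letterSymm 𝔬 c35 a₁ M₁ (fun i hM α₀ hα hMa U h5 h6 => (hmodel i hM α₀ hα hMa U h5 h6).2.2.2.2) hls
  -- (3) the (3.47) pin from the dominations and the readout row
  have hglob : ∀ (i : KIdx 2 ℓ hd3 hL 1 1) (U : (bgT3 i).Cfg) (f : Xo i U),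
      ‖Gop i U f‖ ≤ max ((GG i).glob 0 U (ιo i U f) (-3)) ((GG i).glob 1 U (ιo i U f) (-3)) := by
    intro i U f
    have h0 := (hsg i U (ιo i U f)).2.1 (-3)
    have hpl : ∀ (y : (geo9K i).Site) (n : Fin 4), 0 ≤ B9.pref4 ((geo9K i).len y) n * (geo9K i).len y ^ (-3 : ℝ) := fun y n =>
      mul_nonneg (B9FromB6.pref4_nonneg ((geoOK_geo9K i).lenpos y).le n) (Real.rpow_nonneg ((geoOK_geo9K i).lenpos y).le _)
    refine hread i U f _ (le_max_of_le_left h0.1) (fun x => (hgd0 i U (ιo i U f) (-3) x).trans ?_) (fun w => (hgd1 i U (ιo i U f) (-3) w).trans ?_)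
    · rw [mul_assoc, mul_assoc]
      exact mul_le_mul_of_nonneg_right (le_max_left _ _) (hpl _ 0)
    · rw [mul_assoc, mul_assoc]
      exact mul_le_mul_of_nonneg_right (le_max_right _ _) (hpl _ 1)
  exact normG_row_of_recordObligations 𝔬 H₀ GG bH 𝔭 bHX Dd Dds bHW ev evY r Cev θ₁ θD θ₂ r₁ B₀ B₂ B₄ δ₀ δK σ ρ a₁ M₁ B₃ δ₃ ρ' α κ₀ Bh Bi Bq BhD Bx Bd θH θI θV Br Bi2 Bd2
    hθ₁ hθD hθH hθI hθ₂ hθV hr₁ hB₀ hB₂ hB₃ hB₄ hBr hσ hρ' hρ'ρ hρ'ρ₅ hσρ' hρS hρ₃ hρδ ha₁ hM₁ hα0 hα1 hBi hBd hBi2 hBd2 hBh hBq hBhD hBx hCev hκ hκW hcoR hco1R hcoG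
    hsymGG hl2N hH1N hIF hmodel hleft wZ hwZ hletters hlettersD hG0C hstepD hLHH hLH3 hG0L2 hstepL2 vZ hvZ hLL2 hLIM hCT Gop ιo hw hglob

end Summit.QuantumFields.YangMills.Theorems.Prop7SectET3N06LeavesRecordNormGReduced

end
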